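import Literature.Geometry.Riemannian.RicciFlowScalarCurvature
import HarnessLib

/-!
# Positive isotropic curvature forces positive scalar curvature (Hamilton 1997, §1.2)

Companion ("Proofs") file of `Literature/Geometry/Riemannian/RicciFlowScalarCurvature.lean` for
its named fact `Literature.Geometry.Riemannian.exists_pos_le_scalarCurvature_of_hasPositiveIsotropicCurvature`
(on a compact 4-manifold a Riemannian metric of positive isotropic curvature has scalar curvature
`R ≥ α > 0`; Hamilton 1997, §1.2, pp. 5–6; Chen–Zhu 2006, §4, p. 19). Everything here is proved
except one regularity statement, vendored as a named fact:

1. **Traces in an orthonormal basis** (O'Neill 1983, Ch. 3, Lemma 3.52 and Def. 3.53). For a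
   pseudo-Riemannian metric `g` on `TM` that is positive definite on `T_x M` there is a
   `g_x`-orthonormal basis (`exists_basis_isOrthonormalFrame`, from Mathlib's
   `LinearMap.BilinForm.exists_orthogonal_basis` by normalising); in such a basis `b` the trace of
   an endomorphism `f` is `Σ_i g(f b_i, b_i)`, the metric trace of a bilinear form `T` is
   `Σ_i T(b_i, b_i)`, the Ricci tensor of any covariant derivative `cov` on `TM` is
   `Ric(X, Y) = Σ_m g(R(b_m, X) Y, b_m)` (O'Neill's frame-field formula of Lemma 3.52, in the
   tree's sign convention `Ric(X,Y) = tr (v ↦ R(v,X)Y)`), and the scalar curvature of the pair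
   `(g, cov)` is `R = Σ_i Σ_j Rm(b_j, b_i, b_i, b_j) = Σ_{i ≠ j} K(b_j, b_i)` — O'Neill's
   "contracting relative to a frame field yields `S = Σ_{i≠j} K(E_i, E_j) = 2 Σ_{i<j} K(E_i, E_j)`"
   (Def. 3.53), here for an arbitrary connection (no symmetry `K(X,Y) = K(Y,X)` is used or claimed).
2. **PIC ⇒ `R > 0` pointwise** (`scalarCurvatureWith_pos_of_hasPositiveIsotropicCurvatureWith`):
   on a manifold modelled on a 4-dimensional space, if `g` is Riemannian and the pair `(g, cov)` has
   positive isotropic curvature, then `R(x) > 0` at every point (Hamilton 1997, §1.2, p. 6: the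
   traces of the blocks `A` and `C` "both equal scalar curvature, up to a factor", and PIC gives
   `a₁ + a₂ > 0`, `c₁ + c₂ > 0`; Micallef–Moore 1988, §1). *Proof given here* (elementary, and valid
   for every connection `cov`, not only Levi-Civita ones): by
   `HasPositiveIsotropicCurvatureWith.pos_and_pos_swap_sign` (the frames `(e₁,e₂,e₃,±e₄)`) PIC gives
   `K'(a,c) + K'(a,d) + K'(b,c) + K'(b,d) > 0` for every orthonormal frame `(e_a, e_b, e_c, e_d)`,
   where `K'(i,j) = Rm(e_i, e_j, e_j, e_i)`; the six frames
   `(0,1|2,3), (2,3|0,1), (0,2|1,3), (1,3|0,2), (0,3|1,2), (1,2|0,3)` cover each ordered pair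
   `(i, j)`, `i ≠ j`, exactly twice, so their sum is `2 Σ_{i≠j} K'(i,j) = 2R > 0` by item 1.
3. **Uniform bound on a compact manifold.** The remaining ingredient of the named fact is the
   continuity of `R`; we vend the printed regularity statement — the scalar curvature is a smooth
   function, `S = C(Ric) ∈ 𝔉(M)` (O'Neill 1983, Ch. 3, Def. 3.53, with Lemma 3.35 and Def. 3.51) —
   as the named fact `contMDiff_scalarCurvatureWith` (for a `C^∞` metric and any of its Levi-Civita
   connections, the form in which `scalarCurvatureWith` enters the Ricci-flow facts), and PROVE
   `exists_pos_le_scalarCurvature_of_hasPositiveIsotropicCurvature` from it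
   (`exists_pos_le_scalarCurvature_of_hasPositiveIsotropicCurvature_of_contMDiff`): a continuous
   positive function on a compact space is bounded below by its (positive) minimum.

## References

* R. S. Hamilton, *Four-manifolds with positive isotropic curvature*, Comm. Anal. Geom. 5 (1997)
  1–92, §1.2, Lemma A2.1 (p. 5) and p. 6. [Hamilton1997]
* M. Micallef, J. D. Moore, *Minimal two-spheres and the topology of manifolds with positive
  curvature on totally isotropic two-planes*, Ann. of Math. 127 (1988) 199–227, §1. [MicallefMoore1988]
* B. O'Neill, *Semi-Riemannian geometry*, Academic Press 1983, Ch. 2, Lemmas 24–25 (p. 50: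
  orthonormal bases and orthonormal expansion); Ch. 3: Lemma 3.35, Def. 3.51,
  Lemma 3.52 (`Ric(X,Y) = Σ ε_m ⟨R_{X E_m} Y, E_m⟩`), Def. 3.53 (`S = C(Ric) ∈ 𝔉(M)`,
  `S = Σ_{i≠j} K(E_i,E_j)`), pp. 87–88. [ONeill1983]
* B.-L. Chen, X.-P. Zhu, J. Differential Geom. 74 (2006), §4, p. 19 (arXiv:math/0504478). [ChenZhu2006]
-/

noncomputable section

open Bundle Set Filter Module Finset
open scoped Manifold ContDiff Topology

namespace Literature.Geometry.Riemannian

section PseudoRiemannianMetric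
open Literature.Geometry.Lorentzian (PseudoRiemannianMetric)
open Literature.Geometry.Lorentzian.PseudoRiemannianMetric

variable {E : Type*} [NormedAddCommGroup E] [NormedSpace ℝ E] {H : Type*} [TopologicalSpace H]
  {I : ModelWithCorners ℝ E H} {M : Type*} [TopologicalSpace M] [ChartedSpace H M]
  [IsManifold I ∞ M] {n : ℕ∞ω} [FiniteDimensional ℝ E]
  (g : PseudoRiemannianMetric I n E (TangentSpace I : M → Type _)) {x : M}

/-! ### Orthonormal bases and traces (O'Neill 1983, Ch. 3, Lemma 3.52, Def. 3.53) -/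

/-- **Existence of orthonormal bases.** If `g_x` is positive definite on `T_x M` (e.g. `g`
Riemannian) and the model space has dimension `m`, there is a basis of `T_x M` indexed by `Fin m`
which is a `g_x`-orthonormal frame: take a `g_x`-orthogonal basis (Mathlib's
`LinearMap.BilinForm.exists_orthogonal_basis`) and divide each vector by its (positive) length.
O'Neill 1983, Ch. 2, Lemma 24 (p. 50): "A scalar product space `V ≠ 0` has an orthonormal
basis" (here in the positive definite case, all `ε_i = +1`). [cite: ONeill1983, Ch. 2, Lemma 24 (p. 50)] -/
theorem _root_.Literature.Geometry.Lorentzian.PseudoRiemannianMetric.exists_basis_isOrthonormalFrame (hpos : ∀ v : TangentSpace I x, v ≠ 0 → 0 < g.val x v v)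
    {m : ℕ} (hm : finrank ℝ E = m) :
    ∃ b : Basis (Fin m) ℝ (TangentSpace I x), g.IsOrthonormalFrame x b := by
  classical
  haveI : FiniteDimensional ℝ (TangentSpace I x) := ‹FiniteDimensional ℝ E›
  set q : LinearMap.BilinForm ℝ (TangentSpace I x) := g.toBilinForm x with hqdef
  have hqs : q.IsSymm := g.isSymm_toBilinForm x
  obtain ⟨v, hv⟩ :=
    LinearMap.BilinForm.exists_orthogonal_basis (LinearMap.BilinForm.isSymm_iff.1 hqs)
  have hvpos : ∀ i, 0 < g.val x (v i) (v i) := fun i ↦ hpos _ (v.ne_zero i)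
  set c : Fin (finrank ℝ (TangentSpace I x)) → ℝ := fun i ↦ (Real.sqrt (g.val x (v i) (v i)))⁻¹
    with hcdef
  have hcpos : ∀ i, 0 < c i := fun i ↦ by
    simp only [hcdef]
    exact inv_pos.2 (Real.sqrt_pos.2 (hvpos i))
  have hc : ∀ i, IsUnit (c i) := fun i ↦ (hcpos i).ne'.isUnit
  have hm' : finrank ℝ (TangentSpace I x) = m := hm
  refine ⟨(v.isUnitSMul hc).reindex (finCongr hm'), fun k ↦ ?_, fun k l hkl ↦ ?_⟩
  · simp only [Basis.reindex_apply, Basis.isUnitSMul_apply, map_smul, smul_apply, smul_eq_mul]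
    set i := (finCongr hm').symm k
    have h1 : c i * c i * g.val x (v i) (v i) = 1 := by
      simp only [hcdef]
      rw [← mul_inv, Real.mul_self_sqrt (hvpos i).le, inv_mul_cancel₀ (hvpos i).ne']
    calc c i * (c i * g.val x (v i) (v i)) = c i * c i * g.val x (v i) (v i) := by ring
      _ = 1 := h1
  · simp only [Basis.reindex_apply, Basis.isUnitSMul_apply, map_smul, smul_apply, smul_eq_mul]
    have hij : (finCongr hm').symm k ≠ (finCongr hm').symm l := fun h ↦ hkl (by simpa using h)
    have h0 : g.val x (v ((finCongr hm').symm k)) (v ((finCongr hm').symm l)) = 0 := by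
      have := hv hij
      simpa [hqdef] using this
    rw [h0, mul_zero, mul_zero]

omit [FiniteDimensional ℝ E] in
/-- **Orthonormal expansion** (O'Neill 1983, Ch. 2, Lemma 25: `v = Σ ε_i g(v, e_i) e_i`; here all
`ε_i = 1`): the coordinates of `v` in a `g_x`-orthonormal basis `b` are `b.repr v i = g_x(v, b_i)`.
[cite: ONeill1983, Ch. 2, Lemma 25 (p. 50)] -/
theorem _root_.Literature.Geometry.Lorentzian.PseudoRiemannianMetric.basis_repr_of_isOrthonormalFrame {ι : Type*} [Fintype ι] (b : Basis ι ℝ (TangentSpace I x))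
    (hb : g.IsOrthonormalFrame x b) (v : TangentSpace I x) (i : ι) :
    b.repr v i = g.val x v (b i) := by
  classical
  conv_rhs => rw [← b.sum_repr v]
  rw [map_sum, _root_.sum_apply, Finset.sum_eq_single i]
  · rw [map_smul, smul_apply, hb.1 i, smul_eq_mul, mul_one]
  · intro j _ hji
    rw [map_smul, smul_apply, hb.2 j i hji, smul_zero]
  · intro hi
    exact absurd (Finset.mem_univ i) hi

omit [FiniteDimensional ℝ E] in
/-- **Trace in an orthonormal basis**: `tr f = Σ_i g_x(f b_i, b_i)` for an endomorphism `f` of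
`T_x M` and a `g_x`-orthonormal basis `b` (O'Neill 1983, Ch. 3, Lemma 3.52, "Note the trace
formula"; the Riemannian case `ε_m = 1`). [cite: ONeill1983, Ch. 3, Lemma 3.52] -/
theorem _root_.Literature.Geometry.Lorentzian.PseudoRiemannianMetric.linearMapTrace_eq_sum_of_isOrthonormalFrame {ι : Type*} [Fintype ι]
    (b : Basis ι ℝ (TangentSpace I x)) (hb : g.IsOrthonormalFrame x b)
    (f : TangentSpace I x →ₗ[ℝ] TangentSpace I x) :
    LinearMap.trace ℝ _ f = ∑ i, g.val x (f (b i)) (b i) := by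
  classical
  rw [LinearMap.trace_eq_matrix_trace ℝ b, Matrix.trace]
  simp only [Matrix.diag_apply, LinearMap.toMatrix_apply, g.basis_repr_of_isOrthonormalFrame b hb]

/-- **Metric trace in an orthonormal basis**: `tr_g T = Σ_i T(b_i, b_i)` for a bilinear form `T`
on `T_x M` and a `g_x`-orthonormal basis `b` (O'Neill 1983, Ch. 3, pp. 60–61, 87–88: metric
contraction relative to a frame field). [cite: ONeill1983, Ch. 3, Def. 3.53] -/
theorem _root_.Literature.Geometry.Lorentzian.PseudoRiemannianMetric.trace_eq_sum_of_isOrthonormalFrame {ι : Type*} [Fintype ι]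
    (b : Basis ι ℝ (TangentSpace I x)) (hb : g.IsOrthonormalFrame x b)
    (T : LinearMap.BilinForm ℝ (TangentSpace I x)) :
    g.trace x T = ∑ i, T (b i) (b i) := by
  unfold PseudoRiemannianMetric.trace
  rw [g.linearMapTrace_eq_sum_of_isOrthonormalFrame b hb]
  simp

omit [FiniteDimensional ℝ E] in
/-- **Ricci tensor in an orthonormal basis** (O'Neill 1983, Ch. 3, Lemma 3.52:
`Ric(X,Y) = Σ_m ε_m ⟨R_{X E_m} Y, E_m⟩`; here, with the tree's convention
`Ric(X,Y) = tr (v ↦ R(v,X)Y)` and `ε_m = 1`): `Ric(X, Y) = Σ_m Rm(b_m, X, Y, b_m)` for any covariant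
derivative `cov` on `TM` and any `g_x`-orthonormal basis `b`. [cite: ONeill1983, Ch. 3, Lemma 3.52] -/
theorem _root_.Literature.Geometry.Lorentzian.PseudoRiemannianMetric.ricci_eq_sum_of_isOrthonormalFrame {ι : Type*} [Fintype ι]
    (b : Basis ι ℝ (TangentSpace I x)) (hb : g.IsOrthonormalFrame x b)
    (cov : CovariantDerivative I E (TangentSpace I : M → Type _)) (X₀ Y₀ : TangentSpace I x) :
    cov.ricci x X₀ Y₀ = ∑ m, g.curvatureForm cov x (b m) X₀ Y₀ (b m) := by
  rw [CovariantDerivative.ricci_apply, g.linearMapTrace_eq_sum_of_isOrthonormalFrame b hb]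
  simp [curvatureForm]

/-- **Scalar curvature in an orthonormal basis**: for the pair `(g, cov)`,
`R(x) = Σ_i Σ_j Rm(b_j, b_i, b_i, b_j)` in any `g_x`-orthonormal basis `b` (O'Neill 1983, Ch. 3,
Def. 3.53, contraction relative to a frame field). [cite: ONeill1983, Ch. 3, Def. 3.53] -/
theorem _root_.Literature.Geometry.Lorentzian.PseudoRiemannianMetric.scalarCurvatureWith_eq_sum_of_isOrthonormalFrame {ι : Type*} [Fintype ι]
    (b : Basis ι ℝ (TangentSpace I x)) (hb : g.IsOrthonormalFrame x b)
    (cov : CovariantDerivative I E (TangentSpace I : M → Type _)) :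
    g.scalarCurvatureWith cov x = ∑ i, ∑ j, g.curvatureForm cov x (b j) (b i) (b i) (b j) := by
  rw [scalarCurvatureWith, g.trace_eq_sum_of_isOrthonormalFrame b hb]
  exact Finset.sum_congr rfl fun i _ ↦ g.ricci_eq_sum_of_isOrthonormalFrame b hb cov (b i) (b i)

/-- **`S = Σ_{i ≠ j} K(E_i, E_j)`** (O'Neill 1983, Ch. 3, Def. 3.53, the displayed frame-field
formula): in a `g_x`-orthonormal basis `b` the scalar curvature of `(g, cov)` is the sum over the
ordered pairs `i ≠ j` of the sectional curvatures `K(b_j, b_i) = Rm(b_j, b_i, b_i, b_j)` (the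
diagonal terms vanish since `R(X,X) = 0`). Valid for every covariant derivative on `TM`; for a
Levi-Civita connection `K(X,Y) = K(Y,X)` turns it into `2 Σ_{i<j} K`. [cite: ONeill1983, Ch. 3, Def. 3.53] -/
theorem _root_.Literature.Geometry.Lorentzian.PseudoRiemannianMetric.scalarCurvatureWith_eq_sum_sectionalCurvature {ι : Type*} [Fintype ι] [DecidableEq ι]
    (b : Basis ι ℝ (TangentSpace I x)) (hb : g.IsOrthonormalFrame x b)
    (cov : CovariantDerivative I E (TangentSpace I : M → Type _)) :
    g.scalarCurvatureWith cov x =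
      ∑ i, ∑ j ∈ Finset.univ.filter (· ≠ i), g.sectionalCurvature cov x (b j) (b i) := by
  rw [g.scalarCurvatureWith_eq_sum_of_isOrthonormalFrame b hb cov]
  refine Finset.sum_congr rfl fun i _ ↦ ?_
  rw [← Finset.sum_filter_add_sum_filter_not Finset.univ (· ≠ i)]
  have h0 : ∑ j ∈ Finset.univ.filter (fun j ↦ ¬ j ≠ i), g.curvatureForm cov x (b j) (b i) (b i) (b j)
      = 0 := by
    refine Finset.sum_eq_zero fun j hj ↦ ?_
    have hji : j = i := by simpa using hj
    subst hji
    simp [curvatureForm]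
  rw [h0, add_zero]
  refine Finset.sum_congr rfl fun j hj ↦ ?_
  have hji : j ≠ i := by simpa using hj
  rw [sectionalCurvature_of_orthonormal g cov x (hb.1 j) (hb.1 i) (hb.2 j i hji)]

/-! ### PIC forces `R > 0` (Hamilton 1997, §1.2, p. 6) -/

variable {g} in
omit [FiniteDimensional ℝ E] in
/-- One frame inequality: under PIC, for a `g_x`-orthonormal `e : Fin 4 → T_x M` and distinct
indices `a, b, c, d`, `K'(a,c) + K'(a,d) + K'(b,c) + K'(b,d) > 0` with
`K'(i,j) = Rm(e_i, e_j, e_j, e_i)`: the sum of the two inequalities of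
`HasPositiveIsotropicCurvatureWith.pos_and_pos_swap_sign` for the orthonormal frame
`(e_a, e_b, e_c, e_d)`. [cite: Hamilton1997, §1.2, p. 6] -/
theorem _root_.Literature.Geometry.Lorentzian.PseudoRiemannianMetric.HasPositiveIsotropicCurvatureWith.frame_sum_pos
    {cov : CovariantDerivative I E (TangentSpace I : M → Type _)}
    (h : g.HasPositiveIsotropicCurvatureWith cov) {e : Fin 4 → TangentSpace I x}
    (he : g.IsOrthonormalFrame x e) {a b c d : Fin 4} (hab : a ≠ b) (hac : a ≠ c) (had : a ≠ d)
    (hbc : b ≠ c) (hbd : b ≠ d) (hcd : c ≠ d) :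
    0 < g.curvatureForm cov x (e a) (e c) (e c) (e a) + g.curvatureForm cov x (e a) (e d) (e d) (e a)
      + g.curvatureForm cov x (e b) (e c) (e c) (e b)
      + g.curvatureForm cov x (e b) (e d) (e d) (e b) := by
  set e' : Fin 4 → TangentSpace I x := ![e a, e b, e c, e d] with he'def
  have he' : g.IsOrthonormalFrame x e' := by
    refine ⟨fun i ↦ ?_, fun i j hij ↦ ?_⟩
    · fin_cases i <;> simp [he'def, he.1]
    · fin_cases i <;> fin_cases j <;> first
        | exact absurd rfl hij
        | simp [he'def, he.2 _ _ hab, he.2 _ _ hac, he.2 _ _ had, he.2 _ _ hbc, he.2 _ _ hbd,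
            he.2 _ _ hcd, he.2 _ _ hab.symm, he.2 _ _ hac.symm, he.2 _ _ had.symm,
            he.2 _ _ hbc.symm, he.2 _ _ hbd.symm, he.2 _ _ hcd.symm]
  have h2 := h.pos_and_pos_swap_sign x he'
  simp only [isotropicCurvature, he'def, Fin.isValue, Matrix.cons_val_zero, Matrix.cons_val_one,
    Matrix.cons_val] at h2
  linarith [h2.1, h2.2]

variable {g} in
/-- **Positive isotropic curvature implies positive scalar curvature, pointwise** (Hamilton 1997,
§1.2, p. 6: the traces of the blocks `A` and `C` of the curvature operator "both equal scalar
curvature, up to a factor", and PIC is `a₁ + a₂ > 0 ∧ c₁ + c₂ > 0`, Lemma A2.1; Micallef–Moore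
1988, §1). On a manifold modelled on a 4-dimensional space `E`, if `g` is Riemannian and the pair
`(g, cov)` has positive isotropic curvature then `R(x) = tr_g Ric(cov)_x > 0` at every point.
Proof given here: in a `g_x`-orthonormal basis `R = Σ_{i≠j} K'(i,j)`
(`scalarCurvatureWith_eq_sum_of_isOrthonormalFrame`), and the six frame inequalities
`frame_sum_pos` for `(0,1|2,3), (2,3|0,1), (0,2|1,3), (1,3|0,2), (0,3|1,2), (1,2|0,3)` add up to
`2R > 0`. No symmetry of `Rm` beyond `R(X,X) = 0` is used, so the statement holds for every
connection `cov`. [cite: Hamilton1997, §1.2, p. 6] [cite: MicallefMoore1988, §1] -/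
theorem _root_.Literature.Geometry.Lorentzian.PseudoRiemannianMetric.scalarCurvatureWith_pos_of_hasPositiveIsotropicCurvatureWith (hE : finrank ℝ E = 4)
    (hg : g.IsRiemannian) {cov : CovariantDerivative I E (TangentSpace I : M → Type _)}
    (h : g.HasPositiveIsotropicCurvatureWith cov) (x : M) :
    0 < g.scalarCurvatureWith cov x := by
  obtain ⟨b, hb⟩ := g.exists_basis_isOrthonormalFrame (x := x) (fun v hv ↦ hg x v hv) hE
  rw [g.scalarCurvatureWith_eq_sum_of_isOrthonormalFrame b hb cov]
  simp only [Fin.sum_univ_four, Fin.isValue]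
  have d : ∀ i, g.curvatureForm cov x (b i) (b i) (b i) (b i) = 0 := fun i ↦ by
    simp [curvatureForm]
  have h1 := h.frame_sum_pos hb (a := 0) (b := 1) (c := 2) (d := 3)
    (by decide) (by decide) (by decide) (by decide) (by decide) (by decide)
  have h2 := h.frame_sum_pos hb (a := 2) (b := 3) (c := 0) (d := 1)
    (by decide) (by decide) (by decide) (by decide) (by decide) (by decide)
  have h3 := h.frame_sum_pos hb (a := 0) (b := 2) (c := 1) (d := 3)
    (by decide) (by decide) (by decide) (by decide) (by decide) (by decide)
  have h4 := h.frame_sum_pos hb (a := 1) (b := 3) (c := 0) (d := 2)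
    (by decide) (by decide) (by decide) (by decide) (by decide) (by decide)
  have h5 := h.frame_sum_pos hb (a := 0) (b := 3) (c := 1) (d := 2)
    (by decide) (by decide) (by decide) (by decide) (by decide) (by decide)
  have h6 := h.frame_sum_pos hb (a := 1) (b := 2) (c := 0) (d := 3)
    (by decide) (by decide) (by decide) (by decide) (by decide) (by decide)
  rw [d 0, d 1, d 2, d 3]
  linarith

variable {g} in
/-- The same for the Levi-Civita notion `HasPositiveIsotropicCurvature` (PIC for every Levi-Civita
connection of `g`): `R(cov) > 0` pointwise for every Levi-Civita connection `cov` of a Riemannian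
PIC metric in dimension 4. [cite: Hamilton1997, §1.2, p. 6] -/
theorem _root_.Literature.Geometry.Lorentzian.PseudoRiemannianMetric.scalarCurvatureWith_pos_of_hasPositiveIsotropicCurvature [CompleteSpace E]
    (hE : finrank ℝ E = 4) (hg : g.IsRiemannian) (h : g.HasPositiveIsotropicCurvature)
    {cov : CovariantDerivative I E (TangentSpace I : M → Type _)} (hcov : g.IsLeviCivita cov)
    (x : M) : 0 < g.scalarCurvatureWith cov x :=
  scalarCurvatureWith_pos_of_hasPositiveIsotropicCurvatureWith hE hg (h.with hcov) x

end PseudoRiemannianMetric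

end Literature.Geometry.Riemannian

namespace Literature.Geometry.Riemannian

open Lorentzian Lorentzian.PseudoRiemannianMetric

universe u v w

/-! ### Regularity of the scalar curvature (named fact) and the uniform bound (proved from it) -/

/-- NAMED FACT (**the scalar curvature is a smooth function**; O'Neill 1983, Ch. 3, Def. 3.53:
"The scalar curvature `S` of `M` is the contraction `C(Ric) ∈ 𝔉(M)` of its Ricci tensor", `𝔉(M)`
being the ring of smooth real-valued functions on `M` (Ch. 1), with Lemma 3.35 (the curvature `R`
of the Levi-Civita connection is a tensor field) and Def. 3.51 (`Ric = C¹₃(R) ∈ 𝔗⁰₂(M)`)).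
**Vended form**, in the encoding of this layer: for a `C^∞` pseudo-Riemannian metric `g` on the
tangent bundle of a `C^∞` manifold without boundary (finite-dimensional complete model space)
and any Levi-Civita connection `cov` of `g` (`g.IsLeviCivita cov`: torsion-free and compatible —
by the fundamental lemma, O'Neill Thm. 3.11, proved in the tree as
`PseudoRiemannianMetric.IsLeviCivita.eq_leviCivita_holds`, such a `cov` agrees with the
Levi-Civita connection on differentiable fields), the scalar curvature
`x ↦ scalarCurvatureWith g cov x = tr_g Ric(cov)_x` is a `C^∞` function `M → ℝ`. Users take
`(h : contMDiff_scalarCurvatureWith)`. [cite: ONeill1983, Ch. 3, Def. 3.53] -/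
def contMDiff_scalarCurvatureWith : Prop :=
  ∀ {E : Type u} [NormedAddCommGroup E] [NormedSpace ℝ E] [FiniteDimensional ℝ E]
    [CompleteSpace E] {H : Type v} [TopologicalSpace H] (I : ModelWithCorners ℝ E H)
    [I.Boundaryless] (M : Type w) [TopologicalSpace M] [ChartedSpace H M] [IsManifold I ∞ M]
    (g : PseudoRiemannianMetric I ∞ E (TangentSpace I : M → Type _))
    (cov : CovariantDerivative I E (TangentSpace I : M → Type _)),
    g.IsLeviCivita cov → ContMDiff I 𝓘(ℝ, ℝ) ∞ (fun x ↦ g.scalarCurvatureWith cov x)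

/-- **Discharge of `exists_pos_le_scalarCurvature_of_hasPositiveIsotropicCurvature` down to the
regularity fact.** The named fact of `RicciFlowScalarCurvature.lean` (Hamilton 1997, §1.2,
pp. 5–6; Chen–Zhu 2006, §4, p. 19: on a compact 4-manifold a Riemannian PIC metric has
`R ≥ α > 0`) follows from `contMDiff_scalarCurvatureWith`: pointwise `R > 0` is
`scalarCurvatureWith_pos_of_hasPositiveIsotropicCurvatureWith` (proved above), `R` is continuous
by the regularity fact, and a continuous function on a compact space attains its minimum
(Mathlib's `IsCompact.exists_isMinOn`); for empty `M` any `α > 0` will do.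
[cite: Hamilton1997, §1.2, Lemma A2.1 (p. 5) and p. 6] [cite: ChenZhu2006, §4, p. 19] -/
theorem exists_pos_le_scalarCurvature_of_hasPositiveIsotropicCurvature_of_contMDiff
    (h : contMDiff_scalarCurvatureWith.{0, 0, u}) :
    exists_pos_le_scalarCurvature_of_hasPositiveIsotropicCurvature.{u} := by
  intro M _ _ _ _ _ _ g cov hR hLC hPIC
  have hpos : ∀ x : M, 0 < g.scalarCurvatureWith cov x :=
    scalarCurvatureWith_pos_of_hasPositiveIsotropicCurvatureWith (by simp) hR hPIC
  rcases isEmpty_or_nonempty M with hM | hM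
  · exact ⟨1, one_pos, fun x ↦ (IsEmpty.false x).elim⟩
  have hcont : Continuous (fun x ↦ g.scalarCurvatureWith cov x) :=
    (h (𝓡 4) M g cov hLC).continuous
  obtain ⟨x₀, -, hx₀⟩ := isCompact_univ.exists_isMinOn univ_nonempty hcont.continuousOn
  exact ⟨_, hpos x₀, fun x ↦ hx₀ (mem_univ x)⟩

/-- Sanity check: the regularity fact binds its own manifold data and is universe-polymorphic in
the model space, the model and the manifold. -/
example : contMDiff_scalarCurvatureWith.{u, v, w} ↔
    ∀ {E : Type u} [NormedAddCommGroup E] [NormedSpace ℝ E] [FiniteDimensional ℝ E]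
      [CompleteSpace E] {H : Type v} [TopologicalSpace H] (I : ModelWithCorners ℝ E H)
      [I.Boundaryless] (M : Type w) [TopologicalSpace M] [ChartedSpace H M] [IsManifold I ∞ M]
      (g : PseudoRiemannianMetric I ∞ E (TangentSpace I : M → Type _))
      (cov : CovariantDerivative I E (TangentSpace I : M → Type _)),
      g.IsLeviCivita cov → ContMDiff I 𝓘(ℝ, ℝ) ∞ (fun x ↦ g.scalarCurvatureWith cov x) :=
  Iff.rfl

end Literature.Geometry.Riemannian

end
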